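import Summits.CriticalPhenomena.PercolationContinuityZ3.Theorems.Transplant.RationalHalfSlabTwoOne
import HarnessLib

/-!
# Half-slabs of EVERY RATIONAL DIRECTION `{x ∈ S_k | c ≤ a₁x₁ + a₂x₂}` (`a₁ ≥ a₂ ≥ 0`, `a₁ ≥ 1`, any offset `c`): ONE direction-independent
# station design with slope-`¼` arms — the design file

builds on p205010 (kernel theorem, internal audit signed; external expert review pending) — NOT used in this file.
Lane `prim-bschramm`, seat `prim-bschramm-p2` (gen 23; class C1b, METHOD = input substitution; memo `HOME/bschramm/P2-LATTICES.md` §75);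
helper file (`--supports stmt-CriticalPhenomena-4575 --as helper`).  Gen 22's `RationalHalfSlabTwoOne` (direction `(2,1)`) needed per-direction
constants because slope-`½` arms spread too fast (memo §70 (3b): `Z ≈ N/(1 − a₂/a₁)`).  With the THIN slope-`¼` arms of `ThinConeSlabOwnCriticalPoint`
(`steepSet4`, `exists_thinArm_bound`) ONE set of constants works for every direction with `0 ≤ a₂ ≤ a₁`, `1 ≤ a₁` and every offset `c`, for all
`N ≥ k + 1 + |c|`: station `Ω = (0, 4N+4, -(3N+3))`, right end `Z = 3N+3`, top `T = 7N+7`, window `M = k + 7N + 7`; the direction enters ONLY the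
four domain-membership checks (sweep: `a₁(4N+4) − a₂(3N+3) ≥ a₁(N+1) ≥ N+1 > c`; right/top arms: monotonicity; left arm leaning `−e₂`:
`a₁·4t − a₂t ≥ 0` along the arm), each a `linarith` over the monomials `a_i·x_j`, `a_i·N` after `mul_le_mul_of_nonneg_left`.
* §1 generic: **`innerBdry_faces`** (the four-face classification of the inner boundary of `[-N,N]³` for ANY `D ⊆ S_k`, `N ≥ k+1`),
  **`move_apex_cyl_region`** (the cylindrical station move of `RationalHalfSlabTwoOne.move_apex_cyl` for an ARBITRARY steep region);
* §2 the domain `{x ∈ S_k | c ≤ a₁x₁ + a₂x₂}`: cylindrical; **`dir_innerBdry`** — never the bottom face when `a₂ < a₁ ∨ 0 ≤ c` (for `a₁ = a₂` and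
  `c < 0` the bottom-right corner IS inhabited; those domains are translates of the `c ≥ 0` ones, see the sequel);
* §3 **`dir_vertex_design`**: the increasing event of `P_{p'} ≥ α₄·α` determined inside `[-M,M]³` joining an inner-boundary vertex to the station
  with `≤ k + 2` extra edges through exterior steps of the domain.
Sequel `RationalHalfSlabRow`: uniqueness ∀p, continuity, the full row, general position.
[cite: AizenmanChayesChayesFrohlichRusso1983, §4 Thm 4.4, Lemma 4.2 (a), Lemma 4.3] [cite: BarskyGrimmettNewman1991, Cor. to Thm 1.1 (iii)]
[cite: DuminilCopinSidoraviciusTassion2016, Thm. 1 and §2] -/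

noncomputable section

namespace Summit.CriticalPhenomena.PercolationContinuityZ3.Theorems.Transplant

namespace RationalHalfSlab

open MeasureTheory Literature.Probability.Percolation Literature.Probability.LatticeModels SimpleGraph HSU OrthantUniq HalfSlabUniq
  ConeSlabUniq ThinConeSlab Filter
open scoped Classical Topology

variable {k : ℕ} {D : Set (Site 3)} {N : ℕ}

/-! ## §1 Generic: the four faces of the inner boundary, and the cylindrical station move for an arbitrary steep region -/

/-- **The four-face classification of the inner boundary** of `[-N,N]³` in a slab domain `D ⊆ S_k` (`N ≥ k + 1`): an inner-boundary vertex `u`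
(in the box, with a `D`-neighbour outside) lies in `D` and its outside neighbour is `u + e₁` (top), `u + e₂` (right), `u − e₂` (left) or `u − e₁`
(bottom) — never a thin-coordinate neighbour. [cite: AizenmanChayesChayesFrohlichRusso1983, §4 (4.26)] -/
theorem innerBdry_faces (hD : D ⊆ slab 3 k) (hN : k + 1 ≤ N) {u : Site 3} (hu : u ∈ boxSet 3 N)
    (hw : ∃ w, w ∉ boxSet 3 N ∧ (withinGraph (zdGraph 3) D).Adj u w) :
    u ∈ D ∧ ((u 1 = N ∧ u + Pi.single 1 1 ∈ D) ∨ (u 2 = N ∧ u + Pi.single 2 1 ∈ D) ∨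
      (u 2 = -(N : ℤ) ∧ u - Pi.single 2 1 ∈ D) ∨ (u 1 = -(N : ℤ) ∧ u - Pi.single 1 1 ∈ D)) := by
  obtain ⟨w, hwbox, hadj⟩ := hw
  rw [withinGraph_adj] at hadj
  obtain ⟨hzd, huD, hwD⟩ := hadj
  refine ⟨huD, ?_⟩
  have hw0 : 0 ≤ w 0 ∧ w 0 ≤ (k : ℤ) := hD hwD
  rw [mem_boxSet_iff] at hu hwbox
  push Not at hwbox
  obtain ⟨m, hm⟩ := hwbox
  have hu0 := hu 0; have hu1 := hu 1; have hu2 := hu 2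
  obtain ⟨j, hj | hj⟩ := (zdGraph_adj_iff u w).1 hzd
  · have hwl : ∀ l, w l = u l + (Pi.single j (1 : ℤ) : Site 3) l := fun l => by rw [hj]; rfl
    by_cases hmj : m = j
    · subst hmj
      have h1 := hwl m
      rw [Pi.single_eq_same] at h1
      have hm' : (N : ℤ) < w m := hm (by have := hu m; omega)
      have hum : u m = N := by have := hu m; omega
      have hm3 : m = 0 ∨ m = 1 ∨ m = 2 := by fin_cases m <;> simp
      rcases hm3 with rfl | rfl | rfl
      · exfalso; omega
      · exact Or.inl ⟨hum, by rw [hj] at hwD; exact hwD⟩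
      · exact Or.inr (Or.inl ⟨hum, by rw [hj] at hwD; exact hwD⟩)
    · have h1 := hwl m
      rw [Pi.single_eq_of_ne hmj, add_zero] at h1
      have := hu m; omega
  · have hul : ∀ l, u l = w l + (Pi.single j (1 : ℤ) : Site 3) l := fun l => by rw [hj]; rfl
    by_cases hmj : m = j
    · subst hmj
      have h1 := hul m
      rw [Pi.single_eq_same] at h1
      have hm' : w m < -(N : ℤ) := by
        by_contra h; push Not at h; have := hm h; have := hu m; omega
      have hum : u m = -(N : ℤ) := by have := hu m; omega
      have hwe : w = u - Pi.single m 1 := by rw [hj, add_sub_cancel_right]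
      have hm3 : m = 0 ∨ m = 1 ∨ m = 2 := by fin_cases m <;> simp
      rcases hm3 with rfl | rfl | rfl
      · exfalso; omega
      · exact Or.inr (Or.inr (Or.inr ⟨hum, by rw [hwe] at hwD; exact hwD⟩))
      · exact Or.inr (Or.inr (Or.inl ⟨hum, by rw [hwe] at hwD; exact hwD⟩))
    · have h1 := hul m
      rw [Pi.single_eq_of_ne hmj, add_zero] at h1
      have := hu m; omega

/-- **The station move in a cylindrical slab domain, for an ARBITRARY steep region `S`.**  Let `D ⊆ S_k` be cylindrical (membership depends only on
`(x₁, x₂)`), `Ω ∈ S_k` a station whose truncated shallow region `shallowReg k Ω Z` lies in `D` off the box `[-N,N]³` and below `{x₁ ≤ T}`, and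
`S ⊆ S_k` a region containing the apex `b` (`b₁ ≤ Ω₁`), lying in `D` off the box, inside `{b₁ ≤ x₁ ≤ T}` and inside the strip `{Ω₂ ≤ x₂ ≤ Z}`,
both regions inside `[-M,M]³`.  On the event "`b` reaches `{x₁ = T}` inside `S` and `Ω` reaches `{x₂ = Z}` inside its shallow region" at most `k`
extra open edges of `[-M,M]³` join `b` to `Ω` through open exterior steps of `D`. [cite: AizenmanChayesChayesFrohlichRusso1983, §4 Lemma 4.3, Lemma 4.2 (a)] -/
theorem move_apex_cyl_region (hkN : k ≤ N) (hcyl : ∀ x ∈ D, ∀ y ∈ slab 3 k, y 1 = x 1 → y 2 = x 2 → y ∈ D)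
    {S : Set (Site 3)} {b Ω : Site 3} {T Z : ℤ} (hSslab : S ⊆ slab 3 k) (hbS : b ∈ S) (hΩ : Ω ∈ slab 3 k) (hΩZ : Ω 2 ≤ Z)
    (hbΩ : b 1 ≤ Ω 1)
    (hS : ∀ x ∈ S, x ∈ D ∧ x ∉ boxSet 3 N ∧ (b 1 ≤ x 1 ∧ x 1 ≤ T) ∧ (Ω 2 ≤ x 2 ∧ x 2 ≤ Z))
    (hH : ∀ x ∈ shallowReg k Ω Z, x ∈ D ∧ x ∉ boxSet 3 N ∧ x 1 ≤ T)
    {M : ℕ} (hM : ∀ x ∈ S ∪ shallowReg k Ω Z, ∀ j, |x j| ≤ M)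
    {ω : BondConfig (Site 3)}
    (hω : ω ∈ reachEvent (withinGraph (zdGraph 3) S) b {x | x 1 = T} ∩ reachEvent (withinGraph (zdGraph 3) (shallowReg k Ω Z)) Ω {x | x 2 = Z}) :
    ∃ F : Finset (Sym2 (Site 3)), F ⊆ edgesIn (zdGraph 3) (box 3 M) ∧ F.card ≤ k ∧
      ω ∪ ↑F ∈ openConnVia (starGraph (withinGraph (zdGraph 3) D) Set.univ (boxSet 3 N)) b Ω := by
  refine link_move_region hSslab hbS (fun x hx => (hS x hx).2.2.1) (fun x hx => (hS x hx).2.2.2) hΩ hΩZ hbΩ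
    (fun x hx => (hH x hx).2.2) (withinGraph_le_dext fun x hx => ⟨(hS x hx).1, (hS x hx).2.1⟩)
    (withinGraph_le_dext fun x hx => ⟨(hH x hx).1, (hH x hx).2.1⟩) (fun s hs t ht h1 h2 => withinGraph_le_dext fun z hz => ?_) hM hω
  -- fibre segment between `s` and `t`: in `D` by cylindricity (same `(x₁, x₂)` as `t`), off the box as `t`
  have hs0 := hSslab hs
  have ht0 := (shallowReg_props ht).1
  have hz1 : z 1 = s 1 := eq_of_mem_bbox hz h1
  have hz2 : z 2 = s 2 := eq_of_mem_bbox hz h2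
  have hz0 := hz 0
  have hzslab : z ∈ slab 3 k := ⟨le_trans (le_min hs0.1 ht0.1) hz0.1, le_trans hz0.2 (max_le hs0.2 ht0.2)⟩
  have hzD : z ∈ D := hcyl t (hH t ht).1 z hzslab (by rw [hz1, h1]) (by rw [hz2, h2])
  refine ⟨hzD, fun hzbox => (hH t ht).2.1 ?_⟩
  rw [mem_boxSet_iff] at hzbox ⊢
  intro j
  fin_cases j
  · show -(N : ℤ) ≤ t 0 ∧ t 0 ≤ N
    exact ⟨by have := ht0.1; omega, by have := ht0.2; omega⟩
  · show -(N : ℤ) ≤ t 1 ∧ t 1 ≤ N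
    have := hzbox 1; rw [hz1, h1] at this; exact this
  · show -(N : ℤ) ≤ t 2 ∧ t 2 ≤ N
    have := hzbox 2; rw [hz2, h2] at this; exact this

/-! ## §2 The half-slab of direction `(a₁, a₂)` and offset `c`: `{x ∈ S_k | c ≤ a₁x₁ + a₂x₂}` -/

variable {a₁ a₂ c : ℤ}

/-- Membership. [folklore] -/
theorem mem_dir_iff {x : Site 3} :
    x ∈ {x : Site 3 | x ∈ slab 3 k ∧ c ≤ a₁ * x 1 + a₂ * x 2} ↔ (0 ≤ x 0 ∧ x 0 ≤ (k : ℤ)) ∧ c ≤ a₁ * x 1 + a₂ * x 2 := Iff.rfl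

/-- The domain is cylindrical. [folklore] -/
theorem dir_cyl : ∀ x ∈ {x : Site 3 | x ∈ slab 3 k ∧ c ≤ a₁ * x 1 + a₂ * x 2}, ∀ y ∈ slab 3 k, y 1 = x 1 → y 2 = x 2 →
    y ∈ {x : Site 3 | x ∈ slab 3 k ∧ c ≤ a₁ * x 1 + a₂ * x 2} := by
  intro x hx y hy h1 h2
  exact ⟨hy, by rw [h1, h2]; exact hx.2⟩

/-- The domain lies in the slab. [folklore] -/
theorem dir_subset_slab : {x : Site 3 | x ∈ slab 3 k ∧ c ≤ a₁ * x 1 + a₂ * x 2} ⊆ slab 3 k := fun _ hx => hx.1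

/-- **Classification of the inner boundary of `[-N,N]³` in `{x ∈ S_k | c ≤ a₁x₁ + a₂x₂}`** (`0 ≤ a₂ ≤ a₁`, `1 ≤ a₁`, `a₂ < a₁ ∨ 0 ≤ c`,
`N ≥ k + 1 + |c|`): top face `u₁ = N`, right face `u₂ = N`, or left face `u₂ = -N` with `c ≤ a₁u₁ − a₂(N+1)`; NEVER the bottom face
(`a₁(−N−1) + a₂u₂ ≤ −a₁ − (a₁−a₂)N < c`). [cite: AizenmanChayesChayesFrohlichRusso1983, §4 (4.26)] -/
theorem dir_innerBdry (ha2 : 0 ≤ a₂) (h21 : a₂ ≤ a₁) (ha1 : 1 ≤ a₁) (hH : a₂ < a₁ ∨ 0 ≤ c) (hN : k + 1 + c.natAbs ≤ N) {u : Site 3}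
    (hu : u ∈ boxSet 3 N) (hw : ∃ w, w ∉ boxSet 3 N ∧ (withinGraph (zdGraph 3) {x : Site 3 | x ∈ slab 3 k ∧ c ≤ a₁ * x 1 + a₂ * x 2}).Adj u w) :
    u ∈ {x : Site 3 | x ∈ slab 3 k ∧ c ≤ a₁ * x 1 + a₂ * x 2} ∧
      (u 1 = N ∨ u 2 = N ∨ (u 2 = -(N : ℤ) ∧ c ≤ a₁ * u 1 - a₂ * ((N : ℤ) + 1))) := by
  have hcabs : |c| + 1 + k ≤ (N : ℤ) := by
    have h : ((k + 1 + c.natAbs : ℕ) : ℤ) ≤ N := by exact_mod_cast hN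
    push_cast [Int.natCast_natAbs] at h; linarith
  have hc1 := le_abs_self c
  have hc2 := neg_abs_le c
  obtain ⟨huD, hface⟩ := innerBdry_faces dir_subset_slab (by omega) hu hw
  refine ⟨huD, ?_⟩
  have hub := mem_boxSet_iff.1 hu
  have hu1 := hub 1; have hu2 := hub 2
  rcases hface with ⟨h, -⟩ | ⟨h, -⟩ | ⟨h, hD⟩ | ⟨h, hD⟩
  · exact Or.inl h
  · exact Or.inr (Or.inl h)
  · right; right
    refine ⟨h, ?_⟩
    have h2 := (mem_dir_iff.1 hD).2
    simp only [Pi.sub_apply, Pi.single_eq_same, Pi.single_eq_of_ne (show (1 : Fin 3) ≠ 2 by decide), sub_zero] at h2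
    rw [h] at h2; linarith
  · exfalso
    have h2 := (mem_dir_iff.1 hD).2
    simp only [Pi.sub_apply, Pi.single_eq_same, Pi.single_eq_of_ne (show (2 : Fin 3) ≠ 1 by decide), sub_zero] at h2
    rw [h] at h2
    -- `c ≤ a₁(−N−1) + a₂u₂ ≤ −a₁(N+1) + a₂N`
    have e1 : a₂ * u 2 ≤ a₂ * (N : ℤ) := mul_le_mul_of_nonneg_left hu2.2 ha2
    have hN0 : (0 : ℤ) ≤ (N : ℤ) := by positivity
    rcases hH with hlt | hc0
    · have e2 : a₂ * (N : ℤ) ≤ (a₁ - 1) * (N : ℤ) := mul_le_mul_of_nonneg_right (by omega) hN0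
      nlinarith
    · have e2 : a₂ * (N : ℤ) ≤ a₁ * (N : ℤ) := mul_le_mul_of_nonneg_right h21 hN0
      nlinarith

/-! ## §3 The direction-independent design -/

/-- **The station's region**: `Ω = (0, 4N+4, −(3N+3))`, `Z = 3N+3`, `T = 7N+7` (`N ≥ k + 1 + |c|`, `0 ≤ a₂ ≤ a₁`, `1 ≤ a₁`): inside the domain
(`a₁x₁ + a₂x₂ ≥ a₁(4N+4) − a₂(3N+3) ≥ a₁(N+1) ≥ N+1 > c`), off the box, below `T`. [folklore] -/
theorem dir_station_props (ha2 : 0 ≤ a₂) (h21 : a₂ ≤ a₁) (ha1 : 1 ≤ a₁) (hN : k + 1 + c.natAbs ≤ N) {x : Site 3}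
    (hx : x ∈ shallowReg k ![0, 4 * (N : ℤ) + 4, -(3 * (N : ℤ) + 3)] (3 * (N : ℤ) + 3)) :
    x ∈ {x : Site 3 | x ∈ slab 3 k ∧ c ≤ a₁ * x 1 + a₂ * x 2} ∧ x ∉ boxSet 3 N ∧ x 1 ≤ 7 * (N : ℤ) + 7 := by
  have hcabs : |c| + 1 + k ≤ (N : ℤ) := by
    have h : ((k + 1 + c.natAbs : ℕ) : ℤ) ≤ N := by exact_mod_cast hN
    push_cast [Int.natCast_natAbs] at h; linarith
  have hc1 := le_abs_self c
  obtain ⟨h0, h1, h2, h3, hZ⟩ := shallowReg_props hx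
  simp only [Matrix.cons_val_one, Matrix.cons_val_zero, Matrix.cons_val] at h1 h2 h3
  have e1 : a₁ * (4 * (N : ℤ) + 4) ≤ a₁ * x 1 := mul_le_mul_of_nonneg_left h1 (by linarith)
  have e2 : a₂ * (-(3 * (N : ℤ) + 3)) ≤ a₂ * x 2 := mul_le_mul_of_nonneg_left h3 ha2
  have e3 : a₂ * (3 * (N : ℤ) + 3) ≤ a₁ * (3 * (N : ℤ) + 3) := mul_le_mul_of_nonneg_right h21 (by positivity)
  have e4 : ((N : ℤ) + 1) ≤ a₁ * ((N : ℤ) + 1) := le_mul_of_one_le_left (by positivity) ha1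
  refine ⟨⟨h0, by linarith⟩, not_mem_boxSet_of_lt (j := 1) (by rw [abs_of_nonneg (by omega)]; omega), by omega⟩

/-- **The design at an inner-boundary vertex of `{x ∈ S_k | c ≤ a₁x₁ + a₂x₂}`** (`0 ≤ a₂ ≤ a₁`, `1 ≤ a₁`, `a₂ < a₁ ∨ 0 ≤ c`, `N ≥ k + 1 + |c|`;
`α₄` a thin-arm bound and `A` a slab arm kit at `p'`): an increasing event, measurable, determined by the edges of `[-M,M]³` (`M = k + 7N + 7`), of
`P_{p'} ≥ α₄·α`, on which `≤ k + 2` extra open edges join `u` to the station `Ω = (0, 4N+4, −(3N+3))` through open exterior steps of the domain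
(thin steep arm leaning away from the box from the apex `u + e₁ + e₂` / `u + e₂` / `u − e₂`, top `T = 7N+7`, slope-½ sweep to `x₂ = 3N+3`).
[cite: AizenmanChayesChayesFrohlichRusso1983, §4 Cor. to Lemma 4.3, Lemma 4.2 (a)] -/
theorem dir_vertex_design (ha2 : 0 ≤ a₂) (h21 : a₂ ≤ a₁) (ha1 : 1 ≤ a₁) (hH : a₂ < a₁ ∨ 0 ≤ c) (hN : k + 1 + c.natAbs ≤ N)
    {p' : unitInterval} (A : SlabArmKit k p') {α₄ : ℝ} (hα₄ : 0 < α₄)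
    (harm₄ : ∀ σ : ℤ, (σ = 1 ∨ σ = -1) → ∀ b : Site 3, b ∈ slab 3 k →
      α₄ ≤ (bondPercolation (zdGraph 3) p').real (percolatesVia (withinGraph (zdGraph 3) (steepSet4 k σ b)) b))
    {u : Site 3} (hu : u ∈ boxSet 3 N)
    (hw : ∃ w, w ∉ boxSet 3 N ∧ (withinGraph (zdGraph 3) {x : Site 3 | x ∈ slab 3 k ∧ c ≤ a₁ * x 1 + a₂ * x 2}).Adj u w) :
    ∃ E : Set (BondConfig (Site 3)), IsUpperSet E ∧ MeasurableSet E ∧ DeterminedBy E ↑(edgesIn (zdGraph 3) (box 3 (k + 7 * N + 7))) ∧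
      α₄ * A.α ≤ (bondPercolation (zdGraph 3) p').real E ∧
      ∀ ω ∈ E, ∃ F : Finset (Sym2 (Site 3)), F ⊆ edgesIn (zdGraph 3) (box 3 (k + 7 * N + 7)) ∧ F.card ≤ k + 2 ∧
        ω ∪ ↑F ∈ openConnVia (starGraph (withinGraph (zdGraph 3) {x : Site 3 | x ∈ slab 3 k ∧ c ≤ a₁ * x 1 + a₂ * x 2}) Set.univ (boxSet 3 N)) u
          ![0, 4 * (N : ℤ) + 4, -(3 * (N : ℤ) + 3)] := by
  obtain ⟨huP, hface⟩ := dir_innerBdry ha2 h21 ha1 hH hN hu hw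
  obtain ⟨hu0, huP'⟩ := (mem_dir_iff (k := k)).1 huP
  have hkN : k + 1 ≤ N := by omega
  have hub := mem_boxSet_iff.1 hu
  have hu1 := hub 1; have hu2 := hub 2
  have ha1' : (0 : ℤ) ≤ a₁ := by linarith
  set Ω : Site 3 := ![0, 4 * (N : ℤ) + 4, -(3 * (N : ℤ) + 3)] with hΩ_def
  have hΩ0 : Ω 0 = 0 := by simp [hΩ_def]
  have hΩ1 : Ω 1 = 4 * (N : ℤ) + 4 := by simp [hΩ_def]
  have hΩ2 : Ω 2 = -(3 * (N : ℤ) + 3) := by simp [hΩ_def]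
  have hΩslab : Ω ∈ slab 3 k := by show 0 ≤ Ω 0 ∧ Ω 0 ≤ (k : ℤ); rw [hΩ0]; exact ⟨le_rfl, by positivity⟩
  have hH : ∀ x ∈ shallowReg k Ω (3 * (N : ℤ) + 3), x ∈ {x : Site 3 | x ∈ slab 3 k ∧ c ≤ a₁ * x 1 + a₂ * x 2} ∧ x ∉ boxSet 3 N ∧
      x 1 ≤ 7 * (N : ℤ) + 7 := fun x hx => dir_station_props ha2 h21 ha1 hN hx
  have hwinH : ∀ x ∈ shallowReg k Ω (3 * (N : ℤ) + 3), ∀ j, |x j| ≤ (k + 7 * N + 7 : ℕ) := by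
    intro x hx j
    obtain ⟨h0, h1, h2, h3, hZ⟩ := shallowReg_props hx
    rw [hΩ1] at h1 h2; rw [hΩ2] at h2 h3
    fin_cases j <;> rw [abs_le] <;> push_cast <;> constructor <;> omega
  -- generic packaging: apex `b ∈ S_k` with `-N ≤ b₁ ≤ N+1`, `|b₂| ≤ N+1`, its truncated thin steep region in the domain off the box, an escape of ≤ 2 edges
  have pack : ∀ {σ : ℤ} (_ : σ = 1 ∨ σ = -1) {b : Site 3} (_ : b ∈ slab 3 k) (_ : -(N : ℤ) ≤ b 1) (_ : b 1 ≤ (N : ℤ) + 1) (_ : |b 2| ≤ (N : ℤ) + 1)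
      (_ : ∀ x ∈ steepSet4 k σ b ∩ {x | x 1 ≤ 7 * (N : ℤ) + 7}, x ∈ {x : Site 3 | x ∈ slab 3 k ∧ c ≤ a₁ * x 1 + a₂ * x 2} ∧ x ∉ boxSet 3 N)
      (Esc : Finset (Sym2 (Site 3))) (_ : Esc ⊆ edgesIn (zdGraph 3) (box 3 (k + 7 * N + 7))) (_ : Esc.card ≤ 2)
      (_ : ∀ (ω : BondConfig (Site 3)) (F : Finset (Sym2 (Site 3))), Esc ⊆ F →
        ω ∪ ↑F ∈ openConnVia (starGraph (withinGraph (zdGraph 3) {x : Site 3 | x ∈ slab 3 k ∧ c ≤ a₁ * x 1 + a₂ * x 2}) Set.univ (boxSet 3 N)) b Ω →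
        ω ∪ ↑F ∈ openConnVia (starGraph (withinGraph (zdGraph 3) {x : Site 3 | x ∈ slab 3 k ∧ c ≤ a₁ * x 1 + a₂ * x 2}) Set.univ (boxSet 3 N)) u Ω),
      ∃ E : Set (BondConfig (Site 3)), IsUpperSet E ∧ MeasurableSet E ∧ DeterminedBy E ↑(edgesIn (zdGraph 3) (box 3 (k + 7 * N + 7))) ∧
        α₄ * A.α ≤ (bondPercolation (zdGraph 3) p').real E ∧
        ∀ ω ∈ E, ∃ F : Finset (Sym2 (Site 3)), F ⊆ edgesIn (zdGraph 3) (box 3 (k + 7 * N + 7)) ∧ F.card ≤ k + 2 ∧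
          ω ∪ ↑F ∈ openConnVia (starGraph (withinGraph (zdGraph 3) {x : Site 3 | x ∈ slab 3 k ∧ c ≤ a₁ * x 1 + a₂ * x 2}) Set.univ (boxSet 3 N))
            u Ω := by
    intro σ hσ b hb hb1lo hb1hi hb2 hSD Esc hEsc hEscc hEscMove
    have hb2' := abs_le.1 hb2
    set T : ℤ := 7 * (N : ℤ) + 7 with hT
    set S : Set (Site 3) := steepSet4 k σ b ∩ {x | x 1 ≤ T} with hS_def
    have hbS : b ∈ S := ⟨self_mem_steepSet4 hb, by show b 1 ≤ T; omega⟩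
    have hSprops : ∀ x ∈ S, (0 ≤ x 0 ∧ x 0 ≤ (k : ℤ)) ∧ b 1 ≤ x 1 ∧ x 1 ≤ T ∧ 0 ≤ σ * (x 2 - b 2) ∧ σ * (x 2 - b 2) ≤ 2 * (N : ℤ) + 1 := by
      rintro x ⟨⟨h0, h1, h2⟩, hxT⟩
      have hxT' : x 1 ≤ T := hxT
      exact ⟨h0, by omega, hxT', h1, by omega⟩
    have hSz : ∀ x ∈ S, Ω 2 ≤ x 2 ∧ x 2 ≤ 3 * (N : ℤ) + 3 := by
      intro x hx
      obtain ⟨-, -, -, h1, h2⟩ := hSprops x hx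
      rw [hΩ2]
      rcases hσ with rfl | rfl
      · rw [one_mul] at h1 h2; constructor <;> omega
      · rw [neg_one_mul] at h1 h2; constructor <;> omega
    have hwinS : ∀ x ∈ S, ∀ j, |x j| ≤ (k + 7 * N + 7 : ℕ) := by
      intro x hx j
      obtain ⟨h0, h1, h2, -, -⟩ := hSprops x hx
      obtain ⟨h3, h4⟩ := hSz x hx
      rw [hΩ2] at h3
      fin_cases j <;> rw [abs_le] <;> push_cast <;> constructor <;> omega
    have hM : ∀ x ∈ S ∪ shallowReg k Ω (3 * (N : ℤ) + 3), ∀ j, |x j| ≤ (k + 7 * N + 7 : ℕ) := by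
      rintro x (hx | hx) j
      · exact hwinS x hx j
      · exact hwinH x hx j
    -- the event: thin steep arm from `b` to `{x₁ = T}`, shallow sweep from `Ω` to `{x₂ = Z}`
    set E : Set (BondConfig (Site 3)) := reachEvent (withinGraph (zdGraph 3) S) b {x | x 1 = T} ∩
      reachEvent (withinGraph (zdGraph 3) (shallowReg k Ω (3 * (N : ℤ) + 3))) Ω {x | x 2 = 3 * (N : ℤ) + 3} with hE
    have hSfin : S.Finite := (boxSet_finite _).subset (subset_boxSet_of_abs_le fun x hx => hM x (Or.inl hx))
    have hprobS : α₄ ≤ (bondPercolation (zdGraph 3) p').real (reachEvent (withinGraph (zdGraph 3) S) b {x | x 1 = T}) :=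
      le_real_of_subset (percolatesVia_subset_reachEvent_le (self_mem_steepSet4 hb) 1 (by omega)
        (by simpa [hS_def] using hSfin)) (harm₄ σ hσ b hb)
    have hprobH : A.α ≤ (bondPercolation (zdGraph 3) p').real
        (reachEvent (withinGraph (zdGraph 3) (shallowReg k Ω (3 * (N : ℤ) + 3))) Ω {x | x 2 = 3 * (N : ℤ) + 3}) :=
      le_real_of_subset (percolatesVia_subset_reachEvent_le (self_mem_shallowSet hΩslab) 2 (by rw [hΩ2]; omega)
        (by simpa only [HalfSlabUniq.shallowReg] using shallowReg_finite (k := k) Ω (3 * (N : ℤ) + 3))) (A.shallow_arm Ω hΩslab)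
    refine ⟨E, (isUpperSet_reachEvent _ _ _).inter (isUpperSet_reachEvent _ _ _),
      (measurableSet_reachEvent _ _ _).inter (measurableSet_reachEvent _ _ _), ?_, ?_, fun ω hω => ?_⟩
    · exact ((determinedBy_reachEvent _ _ _).mono (edgeSet_withinGraph_subset_edgesIn (subset_boxSet_of_abs_le fun x hx =>
        hM x (Or.inl hx)))).inter ((determinedBy_reachEvent _ _ _).mono (edgeSet_withinGraph_subset_edgesIn
          (subset_boxSet_of_abs_le fun x hx => hM x (Or.inr hx))))
    · exact harris2_of_le p' (isUpperSet_reachEvent _ _ _) (isUpperSet_reachEvent _ _ _) (measurableSet_reachEvent _ _ _)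
        (measurableSet_reachEvent _ _ _) hα₄.le hprobS hprobH
    · obtain ⟨F, hFs, hFc, hFr⟩ := move_apex_cyl_region (D := {x : Site 3 | x ∈ slab 3 k ∧ c ≤ a₁ * x 1 + a₂ * x 2}) (by omega) dir_cyl
        (S := S) (fun x hx => (hSprops x hx).1) hbS hΩslab (by rw [hΩ2]; omega) (by rw [hΩ1]; omega)
        (fun x hx => ⟨(hSD x hx).1, (hSD x hx).2, ⟨(hSprops x hx).2.1, (hSprops x hx).2.2.1⟩, hSz x hx⟩) hH hM hω
      refine ⟨Esc ∪ F, Finset.union_subset hEsc hFs, (Finset.card_union_le _ _).trans (by omega), ?_⟩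
      exact hEscMove ω (Esc ∪ F) Finset.subset_union_left (openConnVia_mono_finset Finset.subset_union_right hFr)
  have hwu : ∀ j, |u j| ≤ (k + 7 * N + 7 : ℕ) := abs_le_of_mem_boxSet hu (by omega)
  rcases hface with htop | hright | ⟨hleft, hleft'⟩
  · -- TOP face: escape `u → u + e₁ → u + e₁ + e₂`, thin steep arm leaning `+e₂`
    set m : Site 3 := u + Pi.single 1 1 with hm_def
    set b : Site 3 := m + Pi.single 2 1 with hb_def
    have hm0 : m 0 = u 0 := by simp [hm_def]
    have hm1 : m 1 = u 1 + 1 := by simp [hm_def]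
    have hm2 : m 2 = u 2 := by simp [hm_def]
    have hb0 : b 0 = u 0 := by simp [hb_def, hm0]
    have hb1 : b 1 = u 1 + 1 := by simp [hb_def, hm1]
    have hb2 : b 2 = u 2 + 1 := by simp [hb_def, hm2]
    rw [htop] at huP'
    have hmP : m ∈ {x : Site 3 | x ∈ slab 3 k ∧ c ≤ a₁ * x 1 + a₂ * x 2} :=
      ⟨by show 0 ≤ m 0 ∧ m 0 ≤ (k : ℤ); rw [hm0]; exact hu0, by rw [hm1, hm2, htop]; nlinarith⟩
    have hbP : b ∈ {x : Site 3 | x ∈ slab 3 k ∧ c ≤ a₁ * x 1 + a₂ * x 2} :=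
      ⟨by show 0 ≤ b 0 ∧ b 0 ≤ (k : ℤ); rw [hb0]; exact hu0, by rw [hb1, hb2, htop]; nlinarith⟩
    have hmbox : m ∉ boxSet 3 N := not_mem_boxSet_of_lt (j := 1) (by rw [hm1, abs_of_nonneg (by omega)]; omega)
    have hadj1 : (zdGraph 3).Adj u m := (zdGraph_adj_iff _ _).2 ⟨1, Or.inl rfl⟩
    have hadj2 : (zdGraph 3).Adj m b := (zdGraph_adj_iff _ _).2 ⟨2, Or.inl rfl⟩
    have hwm : ∀ j, |m j| ≤ (k + 7 * N + 7 : ℕ) := abs_le_of_mem_boxSet (add_single_mem_boxSet hu 1) (by omega)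
    have hwb : ∀ j, |b j| ≤ (k + 7 * N + 7 : ℕ) := abs_le_of_mem_boxSet (add_single_mem_boxSet (add_single_mem_boxSet hu 1) 2) (by omega)
    refine pack (Or.inl rfl) hbP.1 (by rw [hb1, htop]; omega) (by rw [hb1, htop]) (by rw [hb2, abs_le]; constructor <;> omega)
      (fun x hx => ?_) {s(u, m), s(m, b)} ?_ (Finset.card_insert_le _ _ |>.trans (by simp)) (fun ω F hEF h => ?_)
    · obtain ⟨⟨h0, h1, h2⟩, hxT⟩ := hx
      rw [hb2, one_mul] at h1 h2; rw [hb1, htop] at h2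
      have e1 : a₁ * ((N : ℤ) + 1) ≤ a₁ * x 1 := mul_le_mul_of_nonneg_left (by omega) ha1'
      have e2 : a₂ * (u 2 + 1) ≤ a₂ * x 2 := mul_le_mul_of_nonneg_left (by omega) ha2
      exact ⟨⟨h0, by nlinarith⟩, not_mem_boxSet_of_lt (j := 1) (by rw [abs_of_nonneg (by omega)]; omega)⟩
    · intro e he
      rcases Finset.mem_insert.1 he with rfl | he
      · exact mem_edgesIn_of_adj hadj1 hwu hwm
      · rw [Finset.mem_singleton] at he; rw [he]; exact mem_edgesIn_of_adj hadj2 hwm hwb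
    · refine openConnVia_step (dext_adj_of hadj1 huP hmP fun h' => hmbox h'.2) (hEF (Finset.mem_insert_self _ _))
        (openConnVia_step (dext_adj_of hadj2 hmP hbP fun h' => hmbox h'.1) (hEF ?_) h)
      exact Finset.mem_insert_of_mem (Finset.mem_singleton_self _)
  · -- RIGHT face: escape `u → u + e₂`, thin steep arm leaning `+e₂`
    set b : Site 3 := u + Pi.single 2 1 with hb_def
    have hb0 : b 0 = u 0 := by simp [hb_def]
    have hb1 : b 1 = u 1 := by simp [hb_def]
    have hb2 : b 2 = u 2 + 1 := by simp [hb_def]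
    rw [hright] at huP'
    have hbP : b ∈ {x : Site 3 | x ∈ slab 3 k ∧ c ≤ a₁ * x 1 + a₂ * x 2} :=
      ⟨by show 0 ≤ b 0 ∧ b 0 ≤ (k : ℤ); rw [hb0]; exact hu0, by rw [hb1, hb2, hright]; nlinarith⟩
    have hbbox : b ∉ boxSet 3 N := not_mem_boxSet_of_lt (j := 2) (by rw [hb2, hright, abs_of_nonneg (by omega)]; omega)
    have hadj : (zdGraph 3).Adj u b := (zdGraph_adj_iff _ _).2 ⟨2, Or.inl rfl⟩
    have hwb : ∀ j, |b j| ≤ (k + 7 * N + 7 : ℕ) := abs_le_of_mem_boxSet (add_single_mem_boxSet hu 2) (by omega)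
    refine pack (Or.inl rfl) hbP.1 (by rw [hb1]; omega) (by rw [hb1]; omega) (by rw [hb2, hright]; exact abs_le.2 ⟨by omega, by omega⟩)
      (fun x hx => ?_) {s(u, b)} ?_ (by simp) (fun ω F hEF h => ?_)
    · obtain ⟨⟨h0, h1, h2⟩, hxT⟩ := hx
      rw [hb2, hright, one_mul] at h1 h2; rw [hb1] at h2
      have e1 : a₁ * u 1 ≤ a₁ * x 1 := mul_le_mul_of_nonneg_left (by omega) ha1'
      have e2 : a₂ * ((N : ℤ) + 1) ≤ a₂ * x 2 := mul_le_mul_of_nonneg_left (by omega) ha2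
      exact ⟨⟨h0, by nlinarith⟩, not_mem_boxSet_of_lt (j := 2) (by rw [abs_of_nonneg (by omega)]; omega)⟩
    · intro e he
      rw [Finset.mem_singleton] at he; rw [he]; exact mem_edgesIn_of_adj hadj hwu hwb
    · exact openConnVia_step (dext_adj_of hadj huP hbP fun h' => hbbox h'.2) (hEF (Finset.mem_singleton_self _)) h
  · -- LEFT face (`c ≤ a₁u₁ − a₂(N+1)`): escape `u → u − e₂`, thin steep arm leaning `−e₂`
    set b : Site 3 := u - Pi.single 2 1 with hb_def
    have hb0 : b 0 = u 0 := by simp [hb_def]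
    have hb1 : b 1 = u 1 := by simp [hb_def]
    have hb2 : b 2 = u 2 - 1 := by simp [hb_def]
    have hbP : b ∈ {x : Site 3 | x ∈ slab 3 k ∧ c ≤ a₁ * x 1 + a₂ * x 2} :=
      ⟨by show 0 ≤ b 0 ∧ b 0 ≤ (k : ℤ); rw [hb0]; exact hu0, by rw [hb1, hb2, hleft]; linarith⟩
    have hbbox : b ∉ boxSet 3 N := not_mem_boxSet_of_lt (j := 2) (by rw [hb2, hleft, abs_of_nonpos (by omega)]; omega)
    have hadj : (zdGraph 3).Adj u b := (zdGraph_adj_iff _ _).2 ⟨2, Or.inr (by rw [hb_def, sub_add_cancel])⟩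
    have hwb : ∀ j, |b j| ≤ (k + 7 * N + 7 : ℕ) := abs_le_of_mem_boxSet (sub_single_mem_boxSet hu 2) (by omega)
    refine pack (Or.inr rfl) hbP.1 (by rw [hb1]; omega) (by rw [hb1]; omega) (by rw [hb2, hleft]; exact abs_le.2 ⟨by omega, by omega⟩)
      (fun x hx => ?_) {s(u, b)} ?_ (by simp) (fun ω F hEF h => ?_)
    · obtain ⟨⟨h0, h1, h2⟩, hxT⟩ := hx
      rw [neg_one_mul] at h1 h2; rw [hb1] at h2
      -- along the arm: `t := b₂ − x₂ ≥ 0`, `x₁ ≥ u₁ + 4t`, so `a₁x₁ + a₂x₂ ≥ a₁u₁ − a₂(N+1) + (4a₁ − a₂)t ≥ c`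
      have ht : 0 ≤ b 2 - x 2 := by linarith
      have e1 : a₁ * (u 1 + 4 * (b 2 - x 2)) ≤ a₁ * x 1 := mul_le_mul_of_nonneg_left (by linarith) ha1'
      have e2 : a₂ * (b 2 - x 2) ≤ a₁ * (b 2 - x 2) := mul_le_mul_of_nonneg_right h21 ht
      have e3 : 0 ≤ a₁ * (b 2 - x 2) := mul_nonneg ha1' ht
      have e4 : a₂ * b 2 = -(a₂ * ((N : ℤ) + 1)) := by rw [hb2, hleft]; ring
      refine ⟨⟨h0, by nlinarith⟩, not_mem_boxSet_of_lt (j := 2) ?_⟩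
      rw [abs_of_nonpos (by omega)]; omega
    · intro e he
      rw [Finset.mem_singleton] at he; rw [he]; exact mem_edgesIn_of_adj hadj hwu hwb
    · exact openConnVia_step (dext_adj_of hadj huP hbP fun h' => hbbox h'.2) (hEF (Finset.mem_singleton_self _)) h

end RationalHalfSlab

end Summit.CriticalPhenomena.PercolationContinuityZ3.Theorems.Transplant

end
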